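import Literature.Geometry.Kaehler.ComplexTorusAnalyticCycleClassIntegral
import HarnessLib

/-!
# The cycle class map on the analytic cycles of a complex torus

Layer `Literature/Geometry/Kaehler`; lane `lit-hodgefound`, Layer A4, rows A4-18 / A4-01 (the CONCRETE
cycle class map `cl : Z_d(X) → H^{2p}(X, ℤ) ∩ H^{p,p}` of `SKELETON.md` A4-01 at torus level; programme
Q58, "formal sums / additivity").

An analytic `d`-cycle of the compact complex torus `X = E/Λ` is a holomorphic `d`-chain on `X`
(`HolomorphicChain 𝓘(ℂ, E) (ComplexTorus Φ) d`: a formal `ℤ`-combination `T = Σ k_j Z_j` of irreducible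
closed analytic subsets of pure dimension `d`; on the compact `X` the sum is finite,
`HolomorphicChain.finite_components_of_compactSpace`). Its class is the `ℤ`-combination of the classes of
its components (`ComplexTorus.analyticCycleClass`, rows p07):

* `ComplexTorus.chainCycleClass Φ e h T = Σ_j k_j [Z_j] ∈ Alt^{2p}_ℝ(E; ℂ) = H^{2p}(X, ℂ)` and the group
  homomorphism `ComplexTorus.cycleClassMap Φ e h : Z_d(X) →+ H^{2p}(X, ℂ)`;
* `chainCycleClass_of` — `cl(k [Z]) = k [Z]` for an irreducible `Z`;
* `poincarePairing_chainCycleClass` — `⟨γ, cl(T)⟩ = Σ_j k_j ∫_{Z_j} γ` (the class is the Poincaré dual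
  of the current of integration of the cycle);
* **`chainCycleClass_mem_integralHodgeClasses`** — `cl(T) ∈ H^{2p}(X, ℤ) ∩ H^{p,p}` for EVERY analytic
  cycle (Voisin (2002), Prop. 11.20; Lange (2023), Lemma 6.2.7: the image of the cycle class map consists
  of Hodge classes) — the concrete, hypothesis-free instantiation of the model-relative cycle class map
  of row A4-01.

Definitions with bodies (`setCycleClass`, `chainCycleClass`, `cycleClassMap`) and theorems; no named fact.

## References

* [VoisinHodgeI2002] C. Voisin, *Hodge Theory and Complex Algebraic Geometry I*, CUP (2002), §11.1.2
  Cor. 11.15, §11.1.3 Prop. 11.20.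
* [Lange2023AbelianVarietiesComplex] H. Lange, *Abelian Varieties over the Complex Numbers*, Springer
  (2023), §6.2.1 (cycle class map `cl : Ch^p(X) → H^{2p}(X, ℤ)`, Lemma 6.2.7).
* [Chirka1989] E. M. Chirka, *Complex Analytic Sets*, Kluwer (1989), §11.5 (holomorphic chains).
-/

noncomputable section

open scoped Manifold
open MeasureTheory TopologicalSpace Set Function Module

namespace Literature.Geometry.Kaehler

universe u

/-! ### Chains on a compact manifold have finitely many components -/

namespace HolomorphicChain

variable {E₀ : Type*} [NormedAddCommGroup E₀] [NormedSpace ℂ E₀] {H : Type*} [TopologicalSpace H]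
  {I : ModelWithCorners ℂ E₀ H} {M : Type*} [TopologicalSpace M] [ChartedSpace H M] {p : ℕ}

/-- **A holomorphic chain on a compact manifold has finitely many components** (local finiteness
against the compact set `M` itself; every component is non-empty). [cite: Chirka1989, §11.5 Def., p. 130] -/
theorem finite_components_of_compactSpace [CompactSpace M] (T : HolomorphicChain I M p) : T.components.Finite := by
  refine (T.finite_inter_compact isCompact_univ).subset fun Z hZ ↦ ⟨hZ, ?_⟩
  rw [univ_inter]
  exact (T.hasPureDim_of_mult_ne_zero hZ).nonempty

/-- The components of `k • [Z]` lie in `{Z}`. [cite: Chirka1989, §11.5, p. 130] -/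
theorem components_of_subset {Z : Set M} (hZ : IsIrreducibleAnalyticSet I Z) (hd : HasPureDim I Z p) (k : ℤ) :
    (of Z hZ hd k).components ⊆ {Z} := by
  intro Z' hZ'
  by_contra hne
  exact hZ' (mult_of_of_ne hZ hd k hne)

end HolomorphicChain

/-! ### The cycle class of an analytic cycle of the torus -/

namespace ComplexTorus

variable {ι : Type*} [Fintype ι] [DecidableEq ι] {E : Type u} [NormedAddCommGroup E] [InnerProductSpace ℂ E]
  [FiniteDimensional ℂ E] [MeasurableSpace E] [BorelSpace E] (Φ : (ι → ℝ) ≃L[ℝ] E) {n k d : ℕ}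
  (e : Fin n ≃ ι)

open scoped Classical in
/-- The class of a SUBSET of the torus in degree `k = n − 2d`: the analytic cycle class `[Z]` if `Z` is a
closed analytic subset of pure dimension `d`, and `0` otherwise (total extension, for summation).
[cite: VoisinHodgeI2002, §11.1.2 Cor. 11.15] -/
def setCycleClass (h : 2 * d + k = n) (Z : Set (ComplexTorus Φ)) : E [⋀^Fin k]→L[ℝ] ℂ :=
  if hZ : HasPureDim 𝓘(ℂ, E) Z d then analyticCycleClass Φ e h hZ else 0

/-- On a pure `d`-dimensional analytic subset, `setCycleClass` is the analytic cycle class.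
[cite: VoisinHodgeI2002, §11.1.2 Cor. 11.15] -/
theorem setCycleClass_of_hasPureDim (h : 2 * d + k = n) {Z : Set (ComplexTorus Φ)} (hZ : HasPureDim 𝓘(ℂ, E) Z d) :
    setCycleClass Φ e h Z = analyticCycleClass Φ e h hZ := by
  rw [setCycleClass, dif_pos hZ]

/-- `setCycleClass` of every subset is an integral Hodge class (the analytic class, or `0`).
[cite: VoisinHodgeI2002, §11.1.3 Prop. 11.20] -/
theorem setCycleClass_mem_integralHodgeClasses {p : ℕ} (h : 2 * d + 2 * p = n) (Z : Set (ComplexTorus Φ)) :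
    setCycleClass Φ e h Z ∈ integralHodgeClasses Φ p := by
  by_cases hZ : HasPureDim 𝓘(ℂ, E) Z d
  · rw [setCycleClass_of_hasPureDim Φ e h hZ]
    exact analyticCycleClass_mem_integralHodgeClasses_unconditional Φ e h hZ
  · rw [setCycleClass, dif_neg hZ]
    exact AddSubgroup.zero_mem _

/-- **The class of an analytic `d`-cycle `T = Σ k_j Z_j` of the torus**: `cl(T) = Σ_j k_j [Z_j] ∈
H^{n−2d}(X, ℂ) = Alt^{n−2d}_ℝ(E; ℂ)` (a finite sum, `X` being compact) — the cycle class map of Lange (2023),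
§6.2.1, on analytic cycles, with the classes of the components given by integration (Voisin (2002), §11.1.2).
[cite: Lange2023AbelianVarietiesComplex, §6.2.1] -/
def chainCycleClass (h : 2 * d + k = n) (T : HolomorphicChain 𝓘(ℂ, E) (ComplexTorus Φ) d) :
    E [⋀^Fin k]→L[ℝ] ℂ :=
  ∑ Z ∈ T.finite_components_of_compactSpace.toFinset, T.mult Z • setCycleClass Φ e h Z

/-- The defining sum may be taken over any finite set of subsets containing the components.
[cite: Lange2023AbelianVarietiesComplex, §6.2.1] -/
theorem chainCycleClass_eq_sum_of_subset (h : 2 * d + k = n) (T : HolomorphicChain 𝓘(ℂ, E) (ComplexTorus Φ) d)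
    {S : Finset (Set (ComplexTorus Φ))} (hS : T.components ⊆ S) :
    chainCycleClass Φ e h T = ∑ Z ∈ S, T.mult Z • setCycleClass Φ e h Z := by
  rw [chainCycleClass]
  refine Finset.sum_subset (fun Z hZ ↦ hS (T.finite_components_of_compactSpace.mem_toFinset.1 hZ))
    fun Z _ hZ ↦ ?_
  have h0 : T.mult Z = 0 := by
    by_contra hne
    exact hZ (T.finite_components_of_compactSpace.mem_toFinset.2 hne)
  rw [h0, zero_zsmul]

/-- `cl(0) = 0`. [cite: Lange2023AbelianVarietiesComplex, §6.2.1] -/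
@[simp] theorem chainCycleClass_zero (h : 2 * d + k = n) :
    chainCycleClass Φ e h (0 : HolomorphicChain 𝓘(ℂ, E) (ComplexTorus Φ) d) = 0 := by
  rw [chainCycleClass_eq_sum_of_subset Φ e h 0 (S := ∅) (by simp), Finset.sum_empty]

/-- **Additivity: `cl(T + T') = cl(T) + cl(T')`.** [cite: Lange2023AbelianVarietiesComplex, §6.2.1] -/
theorem chainCycleClass_add (h : 2 * d + k = n) (T T' : HolomorphicChain 𝓘(ℂ, E) (ComplexTorus Φ) d) :
    chainCycleClass Φ e h (T + T') = chainCycleClass Φ e h T + chainCycleClass Φ e h T' := by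
  classical
  set S : Finset (Set (ComplexTorus Φ)) :=
    T.finite_components_of_compactSpace.toFinset ∪ T'.finite_components_of_compactSpace.toFinset with hS
  have hT : T.components ⊆ S := fun Z hZ ↦
    Finset.mem_union_left _ (T.finite_components_of_compactSpace.mem_toFinset.2 hZ)
  have hT' : T'.components ⊆ S := fun Z hZ ↦
    Finset.mem_union_right _ (T'.finite_components_of_compactSpace.mem_toFinset.2 hZ)
  have hTT' : (T + T').components ⊆ S := by
    intro Z hZ
    rw [HolomorphicChain.mem_components_iff, HolomorphicChain.mult_add, Pi.add_apply] at hZ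
    by_cases h1 : T.mult Z = 0
    · rw [h1, zero_add] at hZ
      exact hT' hZ
    · exact hT h1
  rw [chainCycleClass_eq_sum_of_subset Φ e h _ hTT', chainCycleClass_eq_sum_of_subset Φ e h _ hT,
    chainCycleClass_eq_sum_of_subset Φ e h _ hT', ← Finset.sum_add_distrib]
  refine Finset.sum_congr rfl fun Z _ ↦ ?_
  rw [HolomorphicChain.mult_add, Pi.add_apply, add_zsmul]

/-- **The cycle class map `cl : Z_d(X) →+ H^{n−2d}(X, ℂ)`** on the group of analytic `d`-cycles of the
torus, a homomorphism of additive groups. [cite: Lange2023AbelianVarietiesComplex, §6.2.1] -/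
def cycleClassMap (h : 2 * d + k = n) : HolomorphicChain 𝓘(ℂ, E) (ComplexTorus Φ) d →+ E [⋀^Fin k]→L[ℝ] ℂ where
  toFun := chainCycleClass Φ e h
  map_zero' := chainCycleClass_zero Φ e h
  map_add' := chainCycleClass_add Φ e h

/-- Unfolding `cycleClassMap`. [cite: Lange2023AbelianVarietiesComplex, §6.2.1] -/
@[simp] theorem cycleClassMap_apply (h : 2 * d + k = n) (T : HolomorphicChain 𝓘(ℂ, E) (ComplexTorus Φ) d) :
    cycleClassMap Φ e h T = chainCycleClass Φ e h T := rfl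

/-- **`cl(k [Z]) = k [Z]`** for an irreducible closed analytic subset `Z` of pure dimension `d`: on prime
cycles the cycle class map is the analytic cycle class. [cite: VoisinHodgeI2002, §11.1.2 Cor. 11.15] -/
theorem chainCycleClass_of (h : 2 * d + k = n) {Z : Set (ComplexTorus Φ)} (hZ : IsIrreducibleAnalyticSet 𝓘(ℂ, E) Z)
    (hd : HasPureDim 𝓘(ℂ, E) Z d) (m : ℤ) :
    chainCycleClass Φ e h (HolomorphicChain.of Z hZ hd m) = m • analyticCycleClass Φ e h hd := by
  rw [chainCycleClass_eq_sum_of_subset Φ e h _ (S := {Z})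
    (by simpa using HolomorphicChain.components_of_subset hZ hd m),
    Finset.sum_singleton, HolomorphicChain.mult_of_self, setCycleClass_of_hasPureDim Φ e h hd]

/-- `⟨γ, setCycleClass Z⟩ = ∫_Z γ` for a pure `d`-dimensional analytic `Z`. [cite: VoisinHodgeI2002, §11.1.2 Cor. 11.15] -/
theorem poincarePairing_setCycleClass (h : 2 * d + k = n) {Z : Set (ComplexTorus Φ)}
    (hZ : HasPureDim 𝓘(ℂ, E) Z d) (γ : E [⋀^Fin (2 * d)]→L[ℝ] ℂ) :
    poincarePairing Φ e h γ (setCycleClass Φ e h Z) = analyticCyclePeriod Φ hZ γ := by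
  rw [setCycleClass_of_hasPureDim Φ e h hZ, poincarePairing_analyticCycleClass]

/-- **`⟨γ, cl(T)⟩ = Σ_j k_j ∫_{Z_j} γ`**: the class of an analytic cycle is the Poincaré dual of its current
of integration `γ ↦ Σ_j k_j ∫_{Z_j} γ` on the invariant forms (the terms are `k_j ⟨γ, [Z_j]⟩ = k_j ∫_{Z_j} γ`
by `poincarePairing_setCycleClass`). [cite: VoisinHodgeI2002, §11.1.2 Cor. 11.15] -/
theorem poincarePairing_chainCycleClass (h : 2 * d + k = n) (T : HolomorphicChain 𝓘(ℂ, E) (ComplexTorus Φ) d)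
    (γ : E [⋀^Fin (2 * d)]→L[ℝ] ℂ) :
    poincarePairing Φ e h γ (chainCycleClass Φ e h T) =
      ∑ Z ∈ T.finite_components_of_compactSpace.toFinset,
        (T.mult Z : ℂ) * poincarePairing Φ e h γ (setCycleClass Φ e h Z) := by
  rw [chainCycleClass, map_sum]
  refine Finset.sum_congr rfl fun Z _ ↦ ?_
  rw [map_zsmul, zsmul_eq_mul]

/-- **The class of every analytic cycle of a complex torus is an integral Hodge class**:
`cl(T) ∈ H^{2p}(X, ℤ) ∩ H^{p,p} = integralHodgeClasses Φ p` for every analytic `d`-cycle `T` of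
`X = E/Φ(ℤ^ι)`, `2d + 2p = |ι|` (Voisin (2002), Prop. 11.20; Lange (2023), Lemma 6.2.7) — unconditionally.
[cite: VoisinHodgeI2002, §11.1.3 Prop. 11.20] -/
theorem chainCycleClass_mem_integralHodgeClasses {p : ℕ} (h : 2 * d + 2 * p = n)
    (T : HolomorphicChain 𝓘(ℂ, E) (ComplexTorus Φ) d) : chainCycleClass Φ e h T ∈ integralHodgeClasses Φ p :=
  AddSubgroup.sum_mem _ fun Z _ ↦
    AddSubgroup.zsmul_mem _ (setCycleClass_mem_integralHodgeClasses Φ e h Z) _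

/-- … and hence a Hodge class. [cite: Lange2023AbelianVarietiesComplex, §6.2.1 Lemma 6.2.7] -/
theorem chainCycleClass_mem_hodgeClasses {p : ℕ} (h : 2 * d + 2 * p = n)
    (T : HolomorphicChain 𝓘(ℂ, E) (ComplexTorus Φ) d) : chainCycleClass Φ e h T ∈ hodgeClasses Φ p :=
  integralHodgeClasses_subset_hodgeClasses Φ p (chainCycleClass_mem_integralHodgeClasses Φ e h T)

/-- The image of the cycle class map lies in the integral Hodge classes.
[cite: Lange2023AbelianVarietiesComplex, §6.2.1 Lemma 6.2.7] -/
theorem range_cycleClassMap_le {p : ℕ} (h : 2 * d + 2 * p = n) :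
    (cycleClassMap Φ e h (d := d)).range ≤ integralHodgeClasses Φ p := by
  rintro γ ⟨T, rfl⟩
  exact chainCycleClass_mem_integralHodgeClasses Φ e h T

end ComplexTorus

end Literature.Geometry.Kaehler
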